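import Summits.BirchSwinnertonDyer.BirchSwinnertonDyer.Theorems.SignedLowerHalvesSmallImageLowerHalfBothSignsRttD2J2DeltaExact
import Summits.BirchSwinnertonDyer.BirchSwinnertonDyer.Theorems.SignedLowerHalvesSmallImageLowerHalfBothSignsRttD2J2Specialisation
import Summits.BirchSwinnertonDyer.BirchSwinnertonDyer.Theorems.SignedLowerHalvesSmallImageLowerHalfBothSignsRttCharRoadE2JunctionJ2Socket
import Summits.BirchSwinnertonDyer.BirchSwinnertonDyer.Theorems.SignedLowerHalvesSmallImageLowerHalfBothSignsRttD2J2Phi0Ker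
import Summits.BirchSwinnertonDyer.BirchSwinnertonDyer.Theorems.PrintCf2RubinValueTwoJLKDescentRowOneOfClass
import HarnessLib

/-!
# Route `SignedLowerHalves`, crux L `SmallImageLowerHalfBothSigns` (stmt-BirchSwinnertonDyer-23599), line `rtt_w3` v20 — E2, junction stub B, row J2:
# ★★★ ROW J2 IS CLOSED MODULO `hreg` — the specialisation `s = sp¹ : 𝐇¹₂ ⧸ T₂ → 𝐇¹_cyc` EXISTS on the pinned data and `coker s` is finitely generated,
# `Λ`-torsion, with `λ(coker s) ≤ λ(𝐇²₂[T₂])`, as soon as `char_{Λ_{𝒪,2}}(𝐇²₂)` is prime to `T₂`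

LEAD `cruxlead-stmt-BirchSwinnertonDyer-23599` g12 (helper `--supports stmt-BirchSwinnertonDyer-23599`). This file ASSEMBLES row J2 of the registered junction stub
`stub_charRoadJunction_ns` (v20) from the bricks already in the tree: honda g23's corestriction `exists_coresHom` (p782174 lineage, `…RttD2J2Corestriction`) and untwisted
specialisation `exists_specialisationLinearMap_frame_zero` (`…RttD2J2Specialisation`), honda g24's connecting map `deltaTors` with `deltaTors_smul` (`…RttD2J2DeltaAssembly`)
and its exactness `deltaTors_eq_zero_iff_mem_range` (`…RttD2J2DeltaExact`), and the LEAD g11 socket `SmallImageRttCharRoad.junction_coker_of_exact₂` (p786107) at `b = 0`,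
`φ = φ₀`. The frame's generator-pair hypothesis `hγ` supplies `γ₂ ∈ ker κ₁` and `κ₂(γ₂) ∈ ℤ_pˣ` (`SmallImageRttD2J2Delta.of_isTopGeneratorPair_unitTwist`), the cf2 lane's
`PrintCf2.JLKDescent.ramificationSubgroup_suppPF_le_pairLayerSubgroup` supplies `hV`, and `𝔣 ≠ ⊥` the finiteness of `supp(p𝔣)`.

* `ne_bot_of_auxIdeals` — an admissible auxiliary ideal `𝔞 : AuxIdeals p 𝔣` forces `𝔣 ≠ ⊥` (`IsTwist p ⊥ 𝔞` is empty: `IsCoprime 𝔞 ⊥ ⇒ 𝔞 = ⊤`).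
* ★★★ `junction_J2_of_hreg` — for pinned `D₁' D₂'` (degrees 1, 2 of `𝐇ⁱ(𝒪_K[1/p𝔣], Λ_{𝒪,2}(θ')(1))`) and `I` (`𝐇¹_{supp(p𝔣)}(K^{cyc}_∞/K, 𝒪(θ')(1))`), under
  `[Module.Finite Λ_{𝒪,2} D₂'.H]`, `htors : IsTorsion Λ_{𝒪,2} D₂'.H` (both = Thm52Shape transported, in the frame) and `hreg : ¬ char(D₂'.H) ≤ (T₂)`:
  `∃ s : D₁'.H ⧸ T₂ →ₗ[Λ_𝒪] I.H`, pinned levelwise by `I.proj n k (s [y]) = cor_{K̃_n/K^{(1)}_n}(D₁'.proj n k y)`, with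
  `Module.Finite Λ (I.H ⧸ range s) ∧ IsTorsion Λ (I.H ⧸ range s) ∧ λ(I.H ⧸ range s) ≤ λ(D₂'.H[T₂])` — the J2 conjunct of the stub VERBATIM (same pinned instances).
`hreg` is the frame fact the E2 consumer p782277/p784278 derives from the 𝔞-unit and the non-vanishing of the specialised zeta class (p782187
`not_charIdeal_le_span_of_thm52Shape_of_torsionBy_eq_bot` + p777666); inside stub B it follows from the tails ((7′) `hCol` + `L ≠ 0`), so J2 costs the junction nothing beyond them.

THEOREMS ONLY; closes nothing by itself; crux L, crux M, E2, stub B and BSD remain OPEN and are proved for NO curve by any of this.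
References: [PerrinRiou1994Invent] §1.3 (specialisation exact sequence); [JohnsonLeungKings2011] §4.2 Lemma 4.4, Thm. 5.2, Cor. 5.3; [NeukirchSchmidtWingberg2008] I §5 Prop. 1.5.2–1.5.4;
[Washington1997] §13.2; [BourbakiAC5to7] VII §4.5.
-/

set_option autoImplicit false
-- the Theorems namespace of this sub repeats the summit name by design (D-0017 nested layout)
set_option linter.dupNamespace false

noncomputable section

open scoped NumberField
open Field IsDedekindDomain PowerSeries
open Literature.NumberTheory.GaloisRepresentations
open Literature.NumberTheory.EllipticCurves
open Literature.NumberTheory.ComplexMultiplication.EllipticUnits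
open Literature.NumberTheory.ComplexMultiplication.EllipticUnits.JohnsonLeungKings2011
open Summit.BirchSwinnertonDyer.BirchSwinnertonDyer.Theorems.SmallImageRttD2J1
open Summit.BirchSwinnertonDyer.BirchSwinnertonDyer.Theorems.SmallImageRttD2J2

namespace Summit.BirchSwinnertonDyer.BirchSwinnertonDyer.Theorems.SmallImageRttCharRoadJ2

variable {K : Type} [Field K] [NumberField K] {p : ℕ} [Fact p.Prime]

/-! ## §1 `𝔣 ≠ ⊥` from an admissible auxiliary ideal -/

omit [NumberField K] [Fact p.Prime] in
/-- An admissible twist `𝔞` (prime to `6p𝔣`, `≠ 𝒪_K`) exists only for `𝔣 ≠ 0`: `katoModulus6 p ⊥ = ⊥` and `IsCoprime 𝔞 ⊥` forces `𝔞 = ⊤`. [cite: Kato2004Asterisque, §15.6 (p. 254)] -/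
theorem ne_bot_of_auxIdeals {𝔣 : Ideal (𝓞 K)} (a : AuxIdeals p 𝔣) : 𝔣 ≠ ⊥ := by
  rintro rfl
  obtain ⟨hcop, hne⟩ := (isTwist_iff p (⊥ : Ideal (𝓞 K)) a.1).mp a.2
  apply hne
  have h0 : katoModulus6 p (⊥ : Ideal (𝓞 K)) = ⊥ := by rw [katoModulus6, Ideal.mul_bot]
  rw [h0] at hcop
  simpa [Ideal.isCoprime_iff_sup_eq] using hcop

/-! ## §2 Row J2 modulo `hreg` -/

section J2

variable (S : Set (PadicAlgCl p)) [FiniteDimensional ℚ_[p] (padicCoeffField S)] (κ₁ κ₂ : ZpExtension K p) {γ₁ γ₂ : absoluteGaloisGroup K}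
  (θ : absoluteGaloisGroup K →ₜ* (padicCoeffIntegers S)ˣ) (𝔣 : Ideal (𝓞 K))

/-- ★★★ **Row J2 of the junction, modulo `hreg`.** For a generator pair up to units (the frame's `hγ`), `𝔣 ≠ 0`, pinned two-variable data `D₁'`, `D₂'` in degrees `1`, `2`
with `D₂'.H` finitely generated and torsion over `Λ_{𝒪,2}` and `char(D₂'.H)` prime to `T₂ = C (X − C 0)` (`hreg`), and any pinned cyclotomic model `I`: the untwisted
specialisation `s : D₁'.H ⧸ T₂ →ₗ[Λ_𝒪] I.H` (levelwise the corestriction `cor_{K̃_n/K^{(1)}_n}`) has finitely generated `Λ`-torsion cokernel with `λ(coker s) ≤ λ(D₂'.H[T₂])`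
— the pinned `Λ_𝒪`/`Λ`-structures being the canonical ones of the line file (`Module.compHom` along `PowerSeries.map C` and `iwasawaToIwasawaO`, `I.moduleIwasawa`).
Proof: `coker s ↪ D₂'.H[T₂]` semilinearly (`deltaTors`, exactness by Kőnig on the finite layer groups), then the J2 socket.
[cite: PerrinRiou1994Invent, §1.3] [cite: JohnsonLeungKings2011, §4.2 Lemma 4.4, Thm. 5.2] [cite: Washington1997, §13.2] -/
theorem junction_J2_of_hreg (hγ : ∃ u₁ u₂ : ℤ_[p]ˣ, ZpExtension.IsTopGeneratorPair (κ₁.unitTwist u₁) (κ₂.unitTwist u₂) γ₁ γ₂) (h𝔣 : 𝔣 ≠ ⊥)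
    (D₁' : IwasawaCohomologyDataO S κ₁ κ₂ γ₁ γ₂ θ 𝔣 1) (D₂' : IwasawaCohomologyDataO S κ₁ κ₂ γ₁ γ₂ θ 𝔣 2)
    [Module.Finite (IwasawaAlgebraO₂ S) D₂'.H] (htors : Module.IsTorsion (IwasawaAlgebraO₂ S) D₂'.H)
    (hreg : ¬ Module.charIdeal (IwasawaAlgebraO₂ S) D₂'.H ≤
      Ideal.span {(PowerSeries.C (PowerSeries.X - PowerSeries.C (0 : padicCoeffIntegers S)) : IwasawaAlgebraO₂ S)})
    (I : CycIwasawaCohomologyDataO S κ₁ γ₁ θ (suppPF p 𝔣) 1) :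
    letI := I.moduleIwasawa
    haveI := I.isScalarTower_moduleIwasawa
    letI : Algebra (IwasawaAlgebra p) (IwasawaAlgebraO S) := (iwasawaToIwasawaO S).toAlgebra
    letI : Module (IwasawaAlgebraO S) (QuotSMulTop (PowerSeries.C (PowerSeries.X - PowerSeries.C (0 : padicCoeffIntegers S)) : IwasawaAlgebraO₂ S) D₁'.H) :=
      Module.compHom _ (PowerSeries.map (PowerSeries.C : padicCoeffIntegers S →+* IwasawaAlgebraO S))
    letI : Module (IwasawaAlgebra p) (Submodule.torsionBy (IwasawaAlgebraO₂ S) D₂'.H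
        (PowerSeries.C (PowerSeries.X - PowerSeries.C (0 : padicCoeffIntegers S)) : IwasawaAlgebraO₂ S)) :=
      Module.compHom _ ((PowerSeries.map (PowerSeries.C : padicCoeffIntegers S →+* IwasawaAlgebraO S)).comp (iwasawaToIwasawaO S))
    ∃ s : QuotSMulTop (PowerSeries.C (PowerSeries.X - PowerSeries.C (0 : padicCoeffIntegers S)) : IwasawaAlgebraO₂ S) D₁'.H →ₗ[IwasawaAlgebraO S] I.H,
      (∀ (n k : ℕ) (y : D₁'.H), I.proj n k (s (Submodule.Quotient.mk y)) = spLevel S κ₁ κ₂ θ 𝔣 n k 1 (D₁'.proj n k y)) ∧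
      Module.Finite (IwasawaAlgebra p) (I.H ⧸ LinearMap.range s) ∧ Module.IsTorsion (IwasawaAlgebra p) (I.H ⧸ LinearMap.range s) ∧
      lambdaInvariant p (I.H ⧸ LinearMap.range s) ≤
        lambdaInvariant p (Submodule.torsionBy (IwasawaAlgebraO₂ S) D₂'.H
          (PowerSeries.C (PowerSeries.X - PowerSeries.C (0 : padicCoeffIntegers S)) : IwasawaAlgebraO₂ S)) := by
  letI := I.moduleIwasawa
  haveI := I.isScalarTower_moduleIwasawa
  letI : Algebra (IwasawaAlgebra p) (IwasawaAlgebraO S) := (iwasawaToIwasawaO S).toAlgebra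
  letI : Module (IwasawaAlgebraO S) (QuotSMulTop (PowerSeries.C (PowerSeries.X - PowerSeries.C (0 : padicCoeffIntegers S)) : IwasawaAlgebraO₂ S) D₁'.H) :=
    Module.compHom _ (PowerSeries.map (PowerSeries.C : padicCoeffIntegers S →+* IwasawaAlgebraO S))
  letI : Module (IwasawaAlgebra p) (Submodule.torsionBy (IwasawaAlgebraO₂ S) D₂'.H
      (PowerSeries.C (PowerSeries.X - PowerSeries.C (0 : padicCoeffIntegers S)) : IwasawaAlgebraO₂ S)) :=
    Module.compHom _ ((PowerSeries.map (PowerSeries.C : padicCoeffIntegers S →+* IwasawaAlgebraO S)).comp (iwasawaToIwasawaO S))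
  -- the frame's pair hypothesis, unfolded; ramification inside the pair layers; finiteness of the support
  obtain ⟨hγ₁, hγu⟩ := SmallImageRttD2J2Delta.of_isTopGeneratorPair_unitTwist κ₁ κ₂ hγ
  have hV : ∀ m : ℕ, ramificationSubgroup K (suppPF p 𝔣) ≤ JohnsonLeungKings2011.pairLayerSubgroup κ₁ κ₂ m :=
    fun m ↦ PrintCf2.JLKDescent.ramificationSubgroup_suppPF_le_pairLayerSubgroup κ₁ κ₂ 𝔣 m
  have hP : (suppPF p 𝔣).Finite := by
    refine Ideal.finite_factors (mul_ne_zero ?_ h𝔣)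
    rw [Ne, Ideal.zero_eq_bot, Ideal.span_singleton_eq_bot]
    exact_mod_cast (Fact.out : p.Prime).ne_zero
  -- the corestriction and the untwisted specialisation
  obtain ⟨res, hres⟩ := exists_coresHom (S := S) D₁' I
  obtain ⟨s, hs⟩ := exists_specialisationLinearMap_frame_zero (D₂ := D₁') (D₁ := I) hres hγ₁ (fun _ _ ↦ rfl)
  refine ⟨s, fun n k y ↦ by rw [hs, hres], ?_⟩
  -- the connecting map and the socket
  have hsock := SmallImageRttCharRoad.junction_coker_of_exact₂ (S := S) (H2 := D₂'.H) (0 : padicCoeffIntegers S) (phi0 S)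
    (phi0_C_X_sub_C_zero S) (phi0_C_C S) (phi0_X S) (ker_phi0 S) htors hreg (fun _ ↦ rfl) (fun _ _ ↦ rfl) s
    (SmallImageRttD2J2Delta.deltaTors S κ₁ κ₂ θ 𝔣 hγ₁ hγu hV D₂' I)
    (fun l x ↦ SmallImageRttD2J2Delta.deltaTors_smul S κ₁ κ₂ θ 𝔣 hγ₁ hγu hV D₂' I l x)
    (fun x ↦ by
      rw [SmallImageRttD2J2Delta.deltaTors_eq_zero_iff_mem_range S κ₁ κ₂ θ 𝔣 hγ₁ hγu hV D₁' D₂' I res hres hP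
        (Submodule.Quotient.mk) (Submodule.Quotient.mk_surjective _) s hs x, LinearMap.mem_range, Set.mem_range])
  exact hsock

end J2

end Summit.BirchSwinnertonDyer.BirchSwinnertonDyer.Theorems.SmallImageRttCharRoadJ2

end
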